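import Summits.Ventures.YMGap.Thresholds.ConnectedThreePointDecay
import Summits.Ventures.YMGap.Thresholds.CouplingContDiff
import HarnessLib

/-!
# Venture YMGap — C-DIFF2: THE STRONG-COUPLING STATE IS `C²` IN THE COUPLING, with
# `d²/dβ_W² ⟨F⟩_{β_W} = Σ_q Σ_r u₃(F; W_q; W_r)` (`SU(2)`, `d = 4`, every `0 < β_W < 9/25`)

HONEST FRAMING: venture file of the cell `pub-ymgap` (QuantumFields programme), seat ds-1 (gen 10).  Strong-coupling
LATTICE statement for `SU(2)` lattice Yang–Mills on `ℤ^4` with the Wilson action inside the one-sided vertex-star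
window `0 ≤ β_W ≤ 9/25` (tree bare coupling `β_W/2`, `W_q = ½ Re tr U_q`): the (unique) DLR state is TWICE
continuously differentiable in the coupling on Lipschitz cylinder observables, and the second derivative is the
absolutely convergent double plaquette sum of the connected three-point function; `C²`, NOT analyticity; the window
is where the vertex-star bound closes, not a transition; nothing about the continuum, confinement at weak coupling,
or the Clay problem.  Mechanism: g8's C-DIFF (`su2_hasDerivAt_integral_star`: each term `Cov_{β_W}(F, W_q) =
⟨F W_q⟩ − ⟨F⟩⟨W_q⟩` is `C¹` with derivative `Σ_r u₃(F; W_q; W_r)`) + the uniform tree-decay domination of this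
seat's C-SUS3 (`su2_summable_threePoint`) + termwise differentiation of series (Mathlib
`hasDerivAt_tsum_of_isPreconnected`).

For `β₁ ≤ 9/25`, any DLR selection `μ` on `[0, β₁]`, a Lipschitz cylinder `F` (support within `D` of `x₀`):
* `su2_continuousOn_cov_star` — `β_W ↦ Cov_{β_W}(X, Y)` is continuous on `[0, β₁]` for Lipschitz cylinders;
* ★ `su2_hasDerivAt_cov_plaquette_star` — `d/dβ_W Cov_{β_W}(F, W_q) = Σ_r u₃(F; W_q; W_r)` on `(0, β₁)`;
* ★★ `su2_hasDerivAt_responseSum_star` — THE RESPONSE SERIES IS DIFFERENTIABLE: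
  `d/dβ_W Σ_q Cov_{β_W}(F, W_q) = Σ_q Σ_r u₃(F; W_q; W_r)` at every `0 < β_W < β₁`;
* ★★ `su2_hasDerivAt_deriv_integral_star` / `_9_25` — `d²/dβ_W² ⟨F⟩_{β_W} = Σ_q Σ_r u₃(F; W_q; W_r)`;
* `su2_continuousOn_threePointSum` — the double sum is continuous on `[0, β₁]`;
* ★★ `su2_contDiffOn_two_integral_star` / `_9_25` — `β_W ↦ ⟨F⟩_{β_W}` is `ContDiffOn ℝ 2` on `Ioo 0 β₁`;
* `su2_hasDerivAt_deriv_plaquette_9_25` — the mean plaquette `u` is `C²` on `(0, 9/25)` with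
  `u'' = Σ_q Σ_r u₃(W_p; W_q; W_r)`: no first-, second- or third-order transition of the lattice internal energy
  inside the window, as a kernel theorem (the pressure is `C³`: sibling file `PressureThirdDerivative`).

References (mechanism only): B. Simon, *The Statistical Mechanics of Lattice Gases* I (1993), §II.12;
R. L. Dobrushin, S. B. Shlosman (1987) (complete analyticity gives `C^∞`; here `C²` from the vertex-star bound).
-/

noncomputable section

open MeasureTheory ProbabilityTheory Function Finset Filter Topology Real Set
open scoped NNReal
open Literature.MathematicalPhysics.QuantumLattice (LGConfig ZdEdge ZdPlaquette plaquetteEdges fundamentalRep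
  ymGibbsMeasures)
open Literature.MathematicalPhysics.QuantumFieldTheory hiding ZdEdge
open Summit.Ventures.YMGap.DSWindow (starRate starRate_pos)
open Summit.Ventures.YMGap.StarWindowGauge (gaugeR gaugeR_lt_one_of_le)
open Summit.Ventures.YMGap.StarLemmaG (gaugeR_nonneg)
open Summit.Ventures.YMGap.RobustBall (l1 l1_sub_comm numOrient)
open Summit.Ventures.YMGap.LinearResponseBound (summable_and_tsum_base_le)

namespace Summit.Ventures.YMGap.CouplingResponse

/-- Local shorthand: the normalised plaquette observable `W_q = ½ Re tr U_q` of `SU(2)` on `ℤ⁴`. -/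
local notation3 (prettyPrint := false) "W∗" q:max =>
  zdPlaquetteObs (d := 4) (fundamentalRep (Fin 2)) (Prod.fst q) (Prod.snd q).1.1 (Prod.snd q).1.2

/-! ### §1 Continuity of covariances and of the three-point terms in the coupling -/

section Continuity

/-- The links of the plaquette `q` are based within `‖x_q − x₀‖_∞ + 1` of any `x₀`. [folklore] -/
theorem plaquetteEdges_norm_sub_le (q : ZdPlaquette 4) (x₀ : Literature.Probability.LatticeModels.Site 4) :
    ∀ e ∈ plaquetteEdges q,
      ‖e.1 - x₀‖ ≤ ((Literature.Probability.LatticeModels.Site.supNorm (q.1 - x₀) + 1 : ℕ) : ℝ) := by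
  intro e he
  have h1 : ‖e.1 - q.1‖ ≤ 1 := norm_fst_sub_le_of_mem_plaquetteEdges he
  have h2 : ‖q.1 - x₀‖ = Literature.Probability.LatticeModels.Site.supNorm (q.1 - x₀) :=
    Literature.Probability.LatticeModels.Site.norm_eq_supNorm _
  calc ‖e.1 - x₀‖ = ‖(e.1 - q.1) + (q.1 - x₀)‖ := by congr 1; abel
    _ ≤ ‖e.1 - q.1‖ + ‖q.1 - x₀‖ := norm_add_le _ _
    _ ≤ _ := by push_cast; linarith

/-- Supports within `D₁` resp. `D₂` of `x₀` are jointly within `max D₁ D₂`. [folklore] -/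
theorem union_norm_sub_le [DecidableEq (ZdEdge 4)] {Λ₁ Λ₂ : Finset (ZdEdge 4)}
    {x₀ : Literature.Probability.LatticeModels.Site 4} {D₁ D₂ : ℕ}
    (h₁ : ∀ e ∈ Λ₁, ‖e.1 - x₀‖ ≤ D₁) (h₂ : ∀ e ∈ Λ₂, ‖e.1 - x₀‖ ≤ D₂) :
    ∀ e ∈ Λ₁ ∪ Λ₂, ‖e.1 - x₀‖ ≤ ((max D₁ D₂ : ℕ) : ℝ) := by
  intro e he
  rcases Finset.mem_union.1 he with h | h
  · exact (h₁ e h).trans (by exact_mod_cast le_max_left _ _)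
  · exact (h₂ e h).trans (by exact_mod_cast le_max_right _ _)

/-- **Covariances of Lipschitz cylinders are continuous in the coupling** along any DLR selection on `[0, β₁]`,
`β₁ ≤ 9/25` (`Cov = ⟨XY⟩ − ⟨X⟩⟨Y⟩`, each continuous by C-LIP at the star window). [folklore] -/
theorem su2_continuousOn_cov_star {β₁ : ℝ} (h1 : β₁ ≤ 9 / 25)
    {μ : ℝ → Measure (LGConfig 4 (Matrix.specialUnitaryGroup (Fin 2) ℂ))}
    (hμ : ∀ βW ∈ Icc (0 : ℝ) β₁, μ βW ∈ ymGibbsMeasures (d := 4) (fundamentalRep (Fin 2)) (2 * (βW / 4)))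
    {X Y : LGConfig 4 (Matrix.specialUnitaryGroup (Fin 2) ℂ) → ℝ} {Λ₁ Λ₂ : Finset (ZdEdge 4)}
    {K₁ K₂ M₁ M₂ : ℝ≥0}
    (hX : IsLipschitzCylinder (fundamentalRep (Fin 2)) X Λ₁ K₁)
    (hY : IsLipschitzCylinder (fundamentalRep (Fin 2)) Y Λ₂ K₂)
    (hM₁ : ∀ U, |X U| ≤ M₁) (hM₂ : ∀ U, |Y U| ≤ M₂)
    {x₀ : Literature.Probability.LatticeModels.Site 4} {D₁ D₂ : ℕ}
    (hD₁ : ∀ e ∈ Λ₁, ‖e.1 - x₀‖ ≤ D₁) (hD₂ : ∀ e ∈ Λ₂, ‖e.1 - x₀‖ ≤ D₂) :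
    ContinuousOn (fun βW => cov[X, Y; μ βW]) (Icc (0 : ℝ) β₁) := by
  classical
  have hXY := isLipschitzCylinder_mul hX hY hM₁ hM₂
  have c1 := su2_continuousOn_integral h1 hμ hXY (union_norm_sub_le hD₁ hD₂)
  have c2 := su2_continuousOn_integral h1 hμ hX hD₁
  have c3 := su2_continuousOn_integral h1 hμ hY hD₂
  refine ((c1.sub (c2.mul c3)).congr fun βW hb => ?_)
  haveI : IsProbabilityMeasure (μ βW) := (hμ βW hb).1
  exact covariance_eq_sub_of_abs_le hX.measurable hY.measurable hM₁ hM₂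

/-- **Each three-point term is continuous in the coupling**: along any DLR selection on `[0, β₁]`,
`β_W ↦ u₃(F; W_q; W_r)_{μ β_W}` is continuous on `[0, β₁]`. [folklore] -/
theorem su2_continuousOn_threePoint {β₁ : ℝ} (h1 : β₁ ≤ 9 / 25)
    {μ : ℝ → Measure (LGConfig 4 (Matrix.specialUnitaryGroup (Fin 2) ℂ))}
    (hμ : ∀ βW ∈ Icc (0 : ℝ) β₁, μ βW ∈ ymGibbsMeasures (d := 4) (fundamentalRep (Fin 2)) (2 * (βW / 4)))
    {F : LGConfig 4 (Matrix.specialUnitaryGroup (Fin 2) ℂ) → ℝ} {Λ : Finset (ZdEdge 4)} {K : ℝ≥0}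
    (hF : IsLipschitzCylinder (fundamentalRep (Fin 2)) F Λ K)
    {x₀ : Literature.Probability.LatticeModels.Site 4} {D : ℕ} (hD : ∀ e ∈ Λ, ‖e.1 - x₀‖ ≤ D)
    (q r : ZdPlaquette 4) :
    ContinuousOn (fun βW => cov[fun U => F U * (W∗ q) U, W∗ r; μ βW] -
      (∫ U, F U ∂(μ βW)) * cov[W∗ q, W∗ r; μ βW] - (∫ U, (W∗ q) U ∂(μ βW)) * cov[F, W∗ r; μ βW])
      (Icc (0 : ℝ) β₁) := by
  classical
  obtain ⟨hWq, -, hWq1, -, -⟩ := su2_plaquetteObs_data q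
  obtain ⟨hWr, -, hWr1, -, -⟩ := su2_plaquetteObs_data r
  have hFM : ∀ U, |F U| ≤ ((⟨|F 1| + 2 * K, by positivity⟩ : ℝ≥0) : ℝ) := fun U => hF.abs_le U
  have hDq := plaquetteEdges_norm_sub_le q x₀
  have hDr := plaquetteEdges_norm_sub_le r x₀
  have hFW := isLipschitzCylinder_mul hF hWq hFM hWq1
  have hFWb : ∀ U, |F U * (W∗ q) U| ≤ ((⟨|F 1| + 2 * K, by positivity⟩ * 1 : ℝ≥0) : ℝ) := fun U => by
    rw [abs_mul]; push_cast
    exact mul_le_mul (hFM U) (by simpa using hWq1 U) (abs_nonneg _) (by positivity)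
  have c1 := su2_continuousOn_cov_star h1 hμ hFW hWr hFWb hWr1 (union_norm_sub_le hD hDq) hDr
  have c2 := su2_continuousOn_cov_star h1 hμ hWq hWr hWq1 hWr1 hDq hDr
  have c3 := su2_continuousOn_cov_star h1 hμ hF hWr hFM hWr1 hD hDr
  have cF := su2_continuousOn_integral h1 hμ hF hD
  have cW := su2_continuousOn_integral h1 hμ hWq hDq
  exact (c1.sub (cF.mul c2)).sub (cW.mul c3)

end Continuity

/-! ### §2 One term: `Cov_{β_W}(F, W_q)` is `C¹` with derivative `Σ_r u₃(F; W_q; W_r)` -/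

section OneTerm

/-- ★ **The derivative of one response term**: for `β₁ ≤ 9/25`, any DLR selection `μ` on `[0, β₁]`, every
Lipschitz cylinder `F` and plaquette `q`, at every `0 < β_W < β₁`:
`d/dβ_W Cov_{μ β_W}(F, W_q) = Σ_r u₃(F; W_q; W_r)_{μ β_W}` — g8's C-DIFF for `F·W_q`, `F`, `W_q` and the product
rule; the three response series are absolutely convergent (`su2_summable_cov_plaquette_star`). -/
theorem su2_hasDerivAt_cov_plaquette_star {β₁ : ℝ} (h1 : β₁ ≤ 9 / 25)
    {μ : ℝ → Measure (LGConfig 4 (Matrix.specialUnitaryGroup (Fin 2) ℂ))}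
    (hμ : ∀ βW ∈ Icc (0 : ℝ) β₁, μ βW ∈ ymGibbsMeasures (d := 4) (fundamentalRep (Fin 2)) (2 * (βW / 4)))
    {F : LGConfig 4 (Matrix.specialUnitaryGroup (Fin 2) ℂ) → ℝ} {Λ : Finset (ZdEdge 4)} {K : ℝ≥0}
    (hF : IsLipschitzCylinder (fundamentalRep (Fin 2)) F Λ K)
    {x₀ : Literature.Probability.LatticeModels.Site 4} {D : ℕ} (hD : ∀ e ∈ Λ, ‖e.1 - x₀‖ ≤ D)
    (q : ZdPlaquette 4) {βW : ℝ} (hb : βW ∈ Ioo (0 : ℝ) β₁) :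
    HasDerivAt (fun t => cov[F, W∗ q; μ t])
      (∑' r : ZdPlaquette 4, (cov[fun U => F U * (W∗ q) U, W∗ r; μ βW] -
        (∫ U, F U ∂(μ βW)) * cov[W∗ q, W∗ r; μ βW] - (∫ U, (W∗ q) U ∂(μ βW)) * cov[F, W∗ r; μ βW])) βW := by
  classical
  obtain ⟨hWq, hWqm, hWq1, -, -⟩ := su2_plaquetteObs_data q
  have hFM : ∀ U, |F U| ≤ ((⟨|F 1| + 2 * K, by positivity⟩ : ℝ≥0) : ℝ) := fun U => hF.abs_le U
  have hDq := plaquetteEdges_norm_sub_le q x₀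
  have hFW := isLipschitzCylinder_mul hF hWq hFM hWq1
  have hbI : βW ∈ Icc (0 : ℝ) β₁ := ⟨hb.1.le, hb.2.le⟩
  -- the three derivatives
  have d1 := su2_hasDerivAt_integral_star h1 hμ hFW (union_norm_sub_le hD hDq) hb
  have d2 := su2_hasDerivAt_integral_star h1 hμ hF hD hb
  have d3 := su2_hasDerivAt_integral_star h1 hμ hWq hDq hb
  have d := d1.fun_sub (d2.fun_mul d3)
  -- `Cov = ⟨FW⟩ − ⟨F⟩⟨W⟩` near `β_W`
  have hev : (fun t => cov[F, W∗ q; μ t]) =ᶠ[𝓝 βW]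
      fun t => (∫ U, F U * (W∗ q) U ∂(μ t)) - (∫ U, F U ∂(μ t)) * ∫ U, (W∗ q) U ∂(μ t) := by
    filter_upwards [Ioo_mem_nhds hb.1 hb.2] with t ht
    haveI : IsProbabilityMeasure (μ t) := (hμ t ⟨ht.1.le, ht.2.le⟩).1
    exact covariance_eq_sub_of_abs_le hF.measurable hWqm hFM hWq1
  refine (d.congr_of_eventuallyEq hev).congr_deriv ?_
  -- summability of the three response series at `β_W`
  have s1 := su2_summable_cov_plaquette_star h1 hbI.1 hbI.2 (hμ βW hbI) hFW (union_norm_sub_le hD hDq)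
  have s2 := su2_summable_cov_plaquette_star h1 hbI.1 hbI.2 (hμ βW hbI) hF hD
  have s3 := su2_summable_cov_plaquette_star h1 hbI.1 hbI.2 (hμ βW hbI) hWq hDq
  have s3' := s3.mul_left (∫ U, F U ∂(μ βW))
  have s2' := s2.mul_left (∫ U, (W∗ q) U ∂(μ βW))
  rw [(s1.sub s3').tsum_sub s2', s1.tsum_sub s3', tsum_mul_left, tsum_mul_left]
  ring

end OneTerm

/-! ### §3 The response series is differentiable: the state is `C²` in the coupling -/

section Series

/-- ★★ **THE RESPONSE SERIES IS DIFFERENTIABLE IN THE COUPLING** (`SU(2)`, `d = 4`, hypothesis-free): for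
`β₁ ≤ 9/25`, any DLR selection `μ` on `[0, β₁]`, every Lipschitz cylinder `F`, at every `0 < β_W < β₁`:
`d/dβ_W Σ_q Cov_{μ β_W}(F, W_q) = Σ_q Σ_r u₃(F; W_q; W_r)_{μ β_W}` — termwise differentiation
(`hasDerivAt_tsum_of_isPreconnected` on `Ioo 0 β₁`) under the uniform summable domination
`|Σ_r u₃(F; W_q; W_r)| ≤ 2 A D₄((1+r)/(1−r))⁴ r^{‖x₀−x_q‖₁}` of C-SUS3 (`su2_summable_threePoint`). -/
theorem su2_hasDerivAt_responseSum_star {β₁ : ℝ} (h1 : β₁ ≤ 9 / 25)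
    {μ : ℝ → Measure (LGConfig 4 (Matrix.specialUnitaryGroup (Fin 2) ℂ))}
    (hμ : ∀ βW ∈ Icc (0 : ℝ) β₁, μ βW ∈ ymGibbsMeasures (d := 4) (fundamentalRep (Fin 2)) (2 * (βW / 4)))
    {F : LGConfig 4 (Matrix.specialUnitaryGroup (Fin 2) ℂ) → ℝ} {Λ : Finset (ZdEdge 4)} {K : ℝ≥0}
    (hF : IsLipschitzCylinder (fundamentalRep (Fin 2)) F Λ K)
    {x₀ : Literature.Probability.LatticeModels.Site 4} {D : ℕ} (hD : ∀ e ∈ Λ, ‖e.1 - x₀‖ ≤ D)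
    {βW : ℝ} (hb : βW ∈ Ioo (0 : ℝ) β₁) :
    HasDerivAt (fun t => ∑' q : ZdPlaquette 4, cov[F, W∗ q; μ t])
      (∑' q : ZdPlaquette 4, ∑' r : ZdPlaquette 4, (cov[fun U => F U * (W∗ q) U, W∗ r; μ βW] -
        (∫ U, F U ∂(μ βW)) * cov[W∗ q, W∗ r; μ βW] - (∫ U, (W∗ q) U ∂(μ βW)) * cov[F, W∗ r; μ βW])) βW := by
  classical
  have hβ₁0 : 0 ≤ β₁ := hb.1.le.trans hb.2.le
  have hκ : 0 < starRate (gaugeR β₁) :=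
    starRate_pos (gaugeR_nonneg hβ₁0 (by linarith)) (gaugeR_lt_one_of_le hβ₁0 h1)
  set ρ : ℝ := Real.exp (-(starRate (gaugeR β₁) / 16)) with hρ
  set B : ℝ := 2 * (4 * (2 * Real.sqrt 2) ^ 2 * Real.exp (starRate (gaugeR β₁) * (D + 4)) *
    (128 * (((Λ.card : ℝ) + 4) * (32 * (|F 1| + 2 * K) + K)) + 16384 * (|F 1| + 2 * K) +
      1024 * ((Λ.card : ℝ) * K))) * (numOrient 4 * ((1 + ρ) / (1 - ρ)) ^ 4) with hB
  have hρ0 : 0 ≤ ρ := (Real.exp_pos _).le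
  have hρ1 : ρ < 1 := Real.exp_lt_one_iff.2 (by linarith)
  have hK0 : (0 : ℝ) ≤ K := K.2
  have hB0 : 0 ≤ B := by
    have : 0 < 1 - ρ := by linarith
    positivity
  have hbI : βW ∈ Icc (0 : ℝ) β₁ := ⟨hb.1.le, hb.2.le⟩
  refine hasDerivAt_tsum_of_isPreconnected (summable_and_tsum_base_le (d := 4) hB0 hρ0 hρ1 x₀).1 isOpen_Ioo
    (convex_Ioo (0 : ℝ) β₁).isPreconnected (fun q t ht => su2_hasDerivAt_cov_plaquette_star h1 hμ hF hD q ht)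
    (fun q t ht => ?_) hb (su2_summable_cov_plaquette_star h1 hbI.1 hbI.2 (hμ βW hbI) hF hD) hb
  have htI : t ∈ Icc (0 : ℝ) β₁ := ⟨ht.1.le, ht.2.le⟩
  obtain ⟨hs, hle⟩ := su2_summable_threePoint h1 htI.1 htI.2 (hμ t htI) hF hD q
  rw [← hρ, ← hB] at hle
  refine (norm_tsum_le_tsum_norm hs.norm).trans ?_
  simpa only [Real.norm_eq_abs] using hle

/-- ★★ **THE STATE IS TWICE DIFFERENTIABLE IN THE COUPLING**: for `β₁ ≤ 9/25`, any DLR selection `μ` on `[0, β₁]`,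
every Lipschitz cylinder `F` and every `0 < β_W < β₁`:
`d²/dβ_W² ⟨F⟩_{μ β_W} = Σ_q Σ_r u₃(F; W_q; W_r)_{μ β_W}` (the derivative `Σ_q Cov(F, W_q)` of g8's C-DIFF,
differentiated once more). -/
theorem su2_hasDerivAt_deriv_integral_star {β₁ : ℝ} (h1 : β₁ ≤ 9 / 25)
    {μ : ℝ → Measure (LGConfig 4 (Matrix.specialUnitaryGroup (Fin 2) ℂ))}
    (hμ : ∀ βW ∈ Icc (0 : ℝ) β₁, μ βW ∈ ymGibbsMeasures (d := 4) (fundamentalRep (Fin 2)) (2 * (βW / 4)))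
    {F : LGConfig 4 (Matrix.specialUnitaryGroup (Fin 2) ℂ) → ℝ} {Λ : Finset (ZdEdge 4)} {K : ℝ≥0}
    (hF : IsLipschitzCylinder (fundamentalRep (Fin 2)) F Λ K)
    {x₀ : Literature.Probability.LatticeModels.Site 4} {D : ℕ} (hD : ∀ e ∈ Λ, ‖e.1 - x₀‖ ≤ D)
    {βW : ℝ} (hb : βW ∈ Ioo (0 : ℝ) β₁) :
    HasDerivAt (deriv fun t => ∫ U, F U ∂(μ t))
      (∑' q : ZdPlaquette 4, ∑' r : ZdPlaquette 4, (cov[fun U => F U * (W∗ q) U, W∗ r; μ βW] -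
        (∫ U, F U ∂(μ βW)) * cov[W∗ q, W∗ r; μ βW] - (∫ U, (W∗ q) U ∂(μ βW)) * cov[F, W∗ r; μ βW])) βW := by
  refine (su2_hasDerivAt_responseSum_star h1 hμ hF hD hb).congr_of_eventuallyEq ?_
  filter_upwards [Ioo_mem_nhds hb.1 hb.2] with t ht
  exact (su2_hasDerivAt_integral_star h1 hμ hF hD ht).deriv

/-- **The double three-point sum is continuous in the coupling** on `[0, β₁]` along any DLR selection: every
term is continuous (`su2_continuousOn_threePoint`) and the domination of C-SUS3 is uniform on `[0, β₁]`
(`continuousOn_tsum` twice). -/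
theorem su2_continuousOn_threePointSum {β₁ : ℝ} (h1 : β₁ ≤ 9 / 25)
    {μ : ℝ → Measure (LGConfig 4 (Matrix.specialUnitaryGroup (Fin 2) ℂ))}
    (hμ : ∀ βW ∈ Icc (0 : ℝ) β₁, μ βW ∈ ymGibbsMeasures (d := 4) (fundamentalRep (Fin 2)) (2 * (βW / 4)))
    {F : LGConfig 4 (Matrix.specialUnitaryGroup (Fin 2) ℂ) → ℝ} {Λ : Finset (ZdEdge 4)} {K : ℝ≥0}
    (hF : IsLipschitzCylinder (fundamentalRep (Fin 2)) F Λ K)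
    {x₀ : Literature.Probability.LatticeModels.Site 4} {D : ℕ} (hD : ∀ e ∈ Λ, ‖e.1 - x₀‖ ≤ D) :
    ContinuousOn (fun t => ∑' q : ZdPlaquette 4, ∑' r : ZdPlaquette 4,
      (cov[fun U => F U * (W∗ q) U, W∗ r; μ t] - (∫ U, F U ∂(μ t)) * cov[W∗ q, W∗ r; μ t] -
        (∫ U, (W∗ q) U ∂(μ t)) * cov[F, W∗ r; μ t])) (Icc (0 : ℝ) β₁) := by
  classical
  rcases lt_or_ge β₁ 0 with hneg | hβ₁0
  · rw [Set.Icc_eq_empty (by simpa using hneg)]; exact continuousOn_empty _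
  have hκ : 0 < starRate (gaugeR β₁) :=
    starRate_pos (gaugeR_nonneg hβ₁0 (by linarith)) (gaugeR_lt_one_of_le hβ₁0 h1)
  set ρ : ℝ := Real.exp (-(starRate (gaugeR β₁) / 16)) with hρ
  set A : ℝ := 4 * (2 * Real.sqrt 2) ^ 2 * Real.exp (starRate (gaugeR β₁) * (D + 4)) *
    (128 * (((Λ.card : ℝ) + 4) * (32 * (|F 1| + 2 * K) + K)) + 16384 * (|F 1| + 2 * K) +
      1024 * ((Λ.card : ℝ) * K)) with hA
  set B : ℝ := 2 * A * (numOrient 4 * ((1 + ρ) / (1 - ρ)) ^ 4) with hB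
  have hρ0 : 0 ≤ ρ := (Real.exp_pos _).le
  have hρ1 : ρ < 1 := Real.exp_lt_one_iff.2 (by linarith)
  have hK0 : (0 : ℝ) ≤ K := K.2
  have hA0 : 0 ≤ A := by positivity
  have hB0 : 0 ≤ B := by
    have : 0 < 1 - ρ := by linarith
    positivity
  refine continuousOn_tsum (fun q => ?_) (summable_and_tsum_base_le (d := 4) hB0 hρ0 hρ1 x₀).1 (fun q t ht => ?_)
  · -- inner sum: continuous, dominated by `A ρ^{a_q} (ρ^{b_r} + ρ^{c_{qr}})`
    have hAq : 0 ≤ A * ρ ^ l1 (x₀ - q.1) := by positivity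
    have hsum : Summable fun r : ZdPlaquette 4 =>
        A * ρ ^ l1 (x₀ - q.1) * ρ ^ l1 (x₀ - r.1) + A * ρ ^ l1 (x₀ - q.1) * ρ ^ l1 (q.1 - r.1) :=
      (summable_and_tsum_base_le (d := 4) hAq hρ0 hρ1 x₀).1.add (summable_and_tsum_base_le (d := 4) hAq hρ0 hρ1 q.1).1
    refine continuousOn_tsum (fun r => su2_continuousOn_threePoint h1 hμ hF hD q r) hsum (fun r t ht => ?_)
    rw [Real.norm_eq_abs]
    have h := su2_abs_threePoint_le h1 ht.1 ht.2 (hμ t ht) hF hD q r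
    rw [← hρ, ← hA] at h
    linarith
  · obtain ⟨hs, hle⟩ := su2_summable_threePoint h1 ht.1 ht.2 (hμ t ht) hF hD q
    rw [← hρ, ← hA, ← hB] at hle
    refine (norm_tsum_le_tsum_norm hs.norm).trans ?_
    simpa only [Real.norm_eq_abs] using hle

/-- ★★ **`C²` IN THE COUPLING**: for `β₁ ≤ 9/25`, any DLR selection `μ` on `[0, β₁]` and every Lipschitz cylinder
observable `F`, `β_W ↦ ⟨F⟩_{μ β_W}` is `ContDiffOn ℝ 2` on `Ioo 0 β₁`. -/
theorem su2_contDiffOn_two_integral_star {β₁ : ℝ} (h1 : β₁ ≤ 9 / 25)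
    {μ : ℝ → Measure (LGConfig 4 (Matrix.specialUnitaryGroup (Fin 2) ℂ))}
    (hμ : ∀ βW ∈ Icc (0 : ℝ) β₁, μ βW ∈ ymGibbsMeasures (d := 4) (fundamentalRep (Fin 2)) (2 * (βW / 4)))
    {F : LGConfig 4 (Matrix.specialUnitaryGroup (Fin 2) ℂ) → ℝ} {Λ : Finset (ZdEdge 4)} {K : ℝ≥0}
    (hF : IsLipschitzCylinder (fundamentalRep (Fin 2)) F Λ K)
    {x₀ : Literature.Probability.LatticeModels.Site 4} {D : ℕ} (hD : ∀ e ∈ Λ, ‖e.1 - x₀‖ ≤ D) :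
    ContDiffOn ℝ 2 (fun t => ∫ U, F U ∂(μ t)) (Ioo (0 : ℝ) β₁) := by
  rw [show (2 : WithTop ℕ∞) = 1 + 1 from rfl, contDiffOn_succ_iff_deriv_of_isOpen isOpen_Ioo]
  refine ⟨fun t ht => (su2_hasDerivAt_integral_star h1 hμ hF hD ht).differentiableAt.differentiableWithinAt,
    fun h => absurd h (by simp), ?_⟩
  exact contDiffOn_one_of_hasDerivAt (fun t ht => su2_hasDerivAt_deriv_integral_star h1 hμ hF hD ht)
    (su2_continuousOn_threePointSum h1 hμ hF hD)

/-- ★★ **The instance `β₁ = 9/25`**: `d²/dβ_W² ⟨F⟩_{β_W} = Σ_q Σ_r u₃(F; W_q; W_r)` at every `0 < β_W < 9/25 = 0.36`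
('t Hooft `9/100`), for every Lipschitz cylinder observable and any DLR selection, hypothesis-free. -/
theorem su2_hasDerivAt_deriv_integral_9_25
    {μ : ℝ → Measure (LGConfig 4 (Matrix.specialUnitaryGroup (Fin 2) ℂ))}
    (hμ : ∀ βW ∈ Icc (0 : ℝ) (9 / 25), μ βW ∈ ymGibbsMeasures (d := 4) (fundamentalRep (Fin 2)) (2 * (βW / 4)))
    {F : LGConfig 4 (Matrix.specialUnitaryGroup (Fin 2) ℂ) → ℝ} {Λ : Finset (ZdEdge 4)} {K : ℝ≥0}
    (hF : IsLipschitzCylinder (fundamentalRep (Fin 2)) F Λ K)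
    {x₀ : Literature.Probability.LatticeModels.Site 4} {D : ℕ} (hD : ∀ e ∈ Λ, ‖e.1 - x₀‖ ≤ D)
    {βW : ℝ} (hb : βW ∈ Ioo (0 : ℝ) (9 / 25)) :
    HasDerivAt (deriv fun t => ∫ U, F U ∂(μ t))
      (∑' q : ZdPlaquette 4, ∑' r : ZdPlaquette 4, (cov[fun U => F U * (W∗ q) U, W∗ r; μ βW] -
        (∫ U, F U ∂(μ βW)) * cov[W∗ q, W∗ r; μ βW] - (∫ U, (W∗ q) U ∂(μ βW)) * cov[F, W∗ r; μ βW])) βW :=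
  su2_hasDerivAt_deriv_integral_star le_rfl hμ hF hD hb

/-- ★★ **The instance `β₁ = 9/25` of `C²`**: `β_W ↦ ⟨F⟩_{β_W}` is `ContDiffOn ℝ 2` on `Ioo 0 (9/25)` for every
Lipschitz cylinder observable, along any DLR selection — hypothesis-free. -/
theorem su2_contDiffOn_two_integral_9_25
    {μ : ℝ → Measure (LGConfig 4 (Matrix.specialUnitaryGroup (Fin 2) ℂ))}
    (hμ : ∀ βW ∈ Icc (0 : ℝ) (9 / 25), μ βW ∈ ymGibbsMeasures (d := 4) (fundamentalRep (Fin 2)) (2 * (βW / 4)))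
    {F : LGConfig 4 (Matrix.specialUnitaryGroup (Fin 2) ℂ) → ℝ} {Λ : Finset (ZdEdge 4)} {K : ℝ≥0}
    (hF : IsLipschitzCylinder (fundamentalRep (Fin 2)) F Λ K)
    {x₀ : Literature.Probability.LatticeModels.Site 4} {D : ℕ} (hD : ∀ e ∈ Λ, ‖e.1 - x₀‖ ≤ D) :
    ContDiffOn ℝ 2 (fun t => ∫ U, F U ∂(μ t)) (Ioo (0 : ℝ) (9 / 25)) :=
  su2_contDiffOn_two_integral_star le_rfl hμ hF hD

/-- ★ **The mean plaquette is `C²` on `(0, 9/25)`**: `u(β_W) = ⟨W_p⟩_{β_W}` has second derivative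
`u''(β_W) = Σ_q Σ_r u₃(W_p; W_q; W_r)_{β_W}` (the derivative of the plaquette susceptibility) at every
`0 < β_W < 9/25`, any DLR selection — no first-, second- or third-order transition of the lattice internal energy in
the window, as a kernel theorem. -/
theorem su2_hasDerivAt_deriv_plaquette_9_25
    {μ : ℝ → Measure (LGConfig 4 (Matrix.specialUnitaryGroup (Fin 2) ℂ))}
    (hμ : ∀ βW ∈ Icc (0 : ℝ) (9 / 25), μ βW ∈ ymGibbsMeasures (d := 4) (fundamentalRep (Fin 2)) (2 * (βW / 4)))
    (p : ZdPlaquette 4) {βW : ℝ} (hb : βW ∈ Ioo (0 : ℝ) (9 / 25)) :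
    HasDerivAt (deriv fun t => ∫ U, (W∗ p) U ∂(μ t))
      (∑' q : ZdPlaquette 4, ∑' r : ZdPlaquette 4, (cov[fun U => (W∗ p) U * (W∗ q) U, W∗ r; μ βW] -
        (∫ U, (W∗ p) U ∂(μ βW)) * cov[W∗ q, W∗ r; μ βW] - (∫ U, (W∗ q) U ∂(μ βW)) * cov[W∗ p, W∗ r; μ βW])) βW :=
  su2_hasDerivAt_deriv_integral_9_25 hμ (isLipschitzCylinder_zdPlaquetteObs (N := 2) p.1 p.2.2) (x₀ := p.1) (D := 1)
    (fun e he => by simpa using norm_fst_sub_le_of_mem_plaquetteEdges he) hb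

end Series

end Summit.Ventures.YMGap.CouplingResponse

end
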